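import Summits.QuantumFields.BalabanUV.T4Continuum.Support.NE7K1LinTwoRunJensen

/-!
# NE7K1LinTwoRunFaces — row NE7 (node U5), candidate route HOM, path H1L, cell K1-lin(s): TWO-RUN COMPARISON AT `A = 0`, THE
# SHARP UPPER HALF — `⟨V, P_B^{Schur}V⟩ ≤ L·⟨V, P_A V⟩` (Löwner `P_B^{Schur} ⪯ L·P_A`) by the exact FACE COUNT: a coarse bond is
# crossed by `L^d` fine bonds, not `L^{d+1}`

Lineage `b2b-balaban-t4-ne7-p2` (CRUX PROVER NE7 #2), generation 65; successor of `NE7K1LinTwoRunUpper.schurB_form_le` (p292166 ✓,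
crude constant `L²` from «`L^{d+1}` fine points per block»).  With `NE7K1LinTwoRunJensen.runA_form_le_schurB_sharp` (this generation)
it completes lens 2's (K2)♯ pair IN KERNEL: **`P_A ⪯ P_B^{Schur} ⪯ L·P_A`** (`HOME/t4/ideate/NE7/lens2-g26/K2-SHARP-JENSEN-SUPPLY.md`,
graded SOUND at PRICING-NE7 v18 §111 (d); its toy: `C*∕L ∈ [0.33, 0.94]` on ten regions).  Objects of `NE7K1LinSchurLineU1`:
`R′` a union of `L`-blocks, `R = R′.image (blk L)`, chart points `rchart X j = LX + j`.  All [folklore]: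

* §1 block labels of the fine neighbours of a chart point: `LX + j + e_μ` lies in block `X` unless `j_μ = L − 1` (then in
  `X + e_μ`), `LX + j − e_μ` lies in block `X` unless `j_μ = 0` (then in `X − e_μ`); the `2(d+1)` directions `±e_μ` enumerate the
  nearest neighbours EXACTLY (`sum_dir_ite_eq`: `Σ_μ([y = x + e_μ] + [y = x − e_μ])·c = [y ~ x]·c`).
* §2 per chart point and direction (`dirPlus_le ∕ dirMinus_le`): the fine `+e_μ`-neighbour of `LX + j` contributes to the
  nearest-neighbour sum of the block-constant function `V ∘ blk` at most `[j_μ = L−1]·Σ_Y[Y = X + e_μ](V_X − V_Y)²` (and `−e_μ`: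
  `[j_μ = 0]·Σ_Y[Y = X − e_μ](V_X − V_Y)²`); the offsets with `j_μ = L − 1` (resp. `0`) number `L^d`
  (`Fintype.card_filter_piFinset_const_eq_of_mem`), whence **`fineDirichlet_blockConst_le`**:
  `Σ_{x′}Σ_{y′~x′}(V(blk x′) − V(blk y′))² ≤ L^d·Σ_xΣ_{y~x}(V_x − V_y)²` (in fact an equality; `≤` is what is consumed).
* §3 **`schurB_form_le_sharp`**: `⟨V, twoCutoffLine … 1 V⟩ ≤ L·⟨V, runA V⟩` for every `V` (`a > 0`, `n ≥ 1`, `R′` a union of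
  `nL`-blocks): Schur form ≤ block-constant trial (`schurB_form_le_trial`), averaging parts EQUAL (`avgPart_eq`), Dirichlet parts
  `L^{−(d+1)}·(nL)²·L^d = L·n²`.  The natural constant is `O(1)` in `L` (a trial with gradients spread over the block instead of
  concentrated on the face — homogenisation); the block-constant trial cannot see it, and `L` is sharp for THIS trial.

HONEST FRAMING: Gaussian `A = 0`, finite regions, [folklore] over the tree's `B4Lower18` ∕ `NE7K1Lin*` certificates; a supplier
inequality of lens 2 (LÖW B1(i), upper face) made kernel; nothing printed asserted; no `sorry`.  FIXED FINITE T⁴, rung (B)+1; NE7 NOT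
PRINTED ∕ NOT PROVED; spine 0∕9; NOT infinite volume, NOT mass gap, NOT Clay.  HONEST DEPENDENCY: continuum YM on T⁴ ⇐ BetaPertH ∧ nine
spine estimates (0/9 proved); BetaPertH ⇐ (D1) ∧ (D4) ∧ CAP+tail; G-an2-4 gates asym, D1 and NE2/3/4.
-/

noncomputable section

open Finset Matrix

namespace Summit.QuantumFields.BalabanUV.T4Continuum.NE7K1LinTwoRunFaces

open Literature.MathematicalPhysics.QuantumFieldTheory.Balaban1983to89
open Literature.MathematicalPhysics.QuantumFieldTheory.Balaban1983to89.B4Reflection242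
open Literature.MathematicalPhysics.QuantumFieldTheory.Balaban1983to89.B4BoxCov237
open Literature.MathematicalPhysics.QuantumFieldTheory.Balaban1983to89.B4Lower18
open Literature.MathematicalPhysics.QuantumFieldTheory.Balaban1983to89.B4Thm110ZeroBox (blk_blk)
open Literature.MathematicalPhysics.QuantumFieldTheory.Balaban1983to89.B4Green244 (finePt)
open NE7K1LinSchurLineForm NE7K1LinSchurLineCoords NE7K1LinBlockCoords NE7K1LinSchurLineU1 NE7K1LinTwoRunKit
  NE7K1LinTwoRunUpper NE7K1LinTwoRunBonds NE7K1LinTwoRunLower NE7K1LinTwoRunLines NE7K1LinTwoRunJensen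

variable {d : ℕ}

/-! ### §1 Block labels of the fine neighbours of a chart point; the `2(d+1)` directions -/

section Labels

variable {L : ℕ}

/-- `Lx + j + e_μ` as the first step of the straight line. [folklore] -/
theorem finePt_add_uvec_eq_linePt (x : Fin (d + 1) → ℤ) (μ : Fin (d + 1)) (j : Fin (d + 1) → Fin L) :
    finePt L x j + uvec μ = linePt L x μ j 1 := by
  rw [linePt_succ, linePt_zero]

/-- below the upper face (`j_μ + 1 < L`): `Lx + j + e_μ` stays in block `x`. [folklore] -/
theorem blk_finePt_add_uvec_of_lt (hL : 1 ≤ L) (x : Fin (d + 1) → ℤ) (μ : Fin (d + 1)) (j : Fin (d + 1) → Fin L)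
    (h : (j μ : ℕ) + 1 < L) : blk L (finePt L x j + uvec μ) = x := by
  rw [finePt_add_uvec_eq_linePt, linePt_eq_finePt_of_lt x μ j 1 h, blk_finePt hL]

/-- on the upper face (`j_μ + 1 = L`): `Lx + j + e_μ` lies in block `x + e_μ`. [folklore] -/
theorem blk_finePt_add_uvec_of_eq (hL : 1 ≤ L) (x : Fin (d + 1) → ℤ) (μ : Fin (d + 1)) (j : Fin (d + 1) → Fin L)
    (h : (j μ : ℕ) + 1 = L) : blk L (finePt L x j + uvec μ) = x + uvec μ := by
  rw [finePt_add_uvec_eq_linePt, linePt_eq_finePt_of_le x μ j 1 h.symm.le hL, blk_finePt hL]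

/-- above the lower face (`0 < j_μ`): `Lx + j − e_μ` stays in block `x` (it is the chart point at offset `j − e_μ`). [folklore] -/
theorem blk_finePt_sub_uvec_of_pos (hL : 1 ≤ L) (x : Fin (d + 1) → ℤ) (μ : Fin (d + 1)) (j : Fin (d + 1) → Fin L)
    (h : 0 < (j μ : ℕ)) : blk L (finePt L x j - uvec μ) = x := by
  have e : finePt L x j - uvec μ = finePt L x (Function.update j μ ⟨(j μ : ℕ) - 1, by have := (j μ).isLt; omega⟩) := by
    ext ν
    by_cases hν : ν = μ
    · subst hν
      simp only [Pi.sub_apply, finePt_apply, uvec_apply_same, Function.update_self]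
      push_cast [Nat.cast_sub (show 1 ≤ (j ν : ℕ) from h)]
      ring
    · simp only [Pi.sub_apply, finePt_apply, uvec_apply_ne hν, Function.update_of_ne hν, sub_zero]
  rw [e, blk_finePt hL]

/-- on the lower face (`j_μ = 0`): `Lx + j − e_μ` lies in block `x − e_μ` (chart point at offset `j + (L−1)e_μ`). [folklore] -/
theorem blk_finePt_sub_uvec_of_zero (hL : 1 ≤ L) (x : Fin (d + 1) → ℤ) (μ : Fin (d + 1)) (j : Fin (d + 1) → Fin L)
    (h : (j μ : ℕ) = 0) : blk L (finePt L x j - uvec μ) = x - uvec μ := by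
  have e : finePt L x j - uvec μ = finePt L (x - uvec μ) (Function.update j μ ⟨L - 1, by omega⟩) := by
    ext ν
    by_cases hν : ν = μ
    · subst hν
      simp only [Pi.sub_apply, finePt_apply, uvec_apply_same, Function.update_self, h]
      push_cast [Nat.cast_sub hL]
      ring
    · simp only [Pi.sub_apply, finePt_apply, uvec_apply_ne hν, Function.update_of_ne hν, sub_zero]
  rw [e, blk_finePt hL]

/-- **THE `2(d+1)` DIRECTIONS ENUMERATE THE NEAREST NEIGHBOURS EXACTLY**: for lattice points `x, y` and `c : ℝ`,
`Σ_μ([y = x + e_μ]·c + [y = x − e_μ]·c) = [y ∈ nbrs x]·c`. [folklore] -/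
theorem sum_dir_ite_eq (x y : Fin (d + 1) → ℤ) (c : ℝ) :
    ∑ μ : Fin (d + 1), ((if y = x + uvec μ then c else 0) + (if y = x - uvec μ then c else 0)) =
      if y ∈ nbrs x then c else 0 := by
  classical
  by_cases h : y ∈ nbrs x
  · rw [if_pos h]
    obtain ⟨μ₀, h₀ | h₀⟩ := mem_nbrs.1 h
    · have h₀' : y = x + uvec μ₀ := h₀
      rw [Finset.sum_eq_single μ₀]
      · have hne : ¬ (y = x - uvec μ₀) := fun h' =>
          uvec_add_uvec_ne_zero μ₀ μ₀ (by have := h₀'.symm.trans h'; linear_combination this)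
        rw [if_pos h₀', if_neg hne, add_zero]
      · intro μ _ hμ
        have h1 : ¬ (y = x + uvec μ) := fun h' => hμ (uvec_injective (add_left_cancel (h'.symm.trans h₀')))
        have h2 : ¬ (y = x - uvec μ) := fun h' =>
          uvec_add_uvec_ne_zero μ₀ μ (by have := h₀'.symm.trans h'; linear_combination this)
        rw [if_neg h1, if_neg h2, add_zero]
      · intro hμ; exact absurd (Finset.mem_univ μ₀) hμ
    · have h₀' : y = x - uvec μ₀ := h₀
      rw [Finset.sum_eq_single μ₀]
      · have hne : ¬ (y = x + uvec μ₀) := fun h' =>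
          uvec_add_uvec_ne_zero μ₀ μ₀ (by have := h'.symm.trans h₀'; linear_combination this)
        rw [if_neg hne, if_pos h₀', zero_add]
      · intro μ _ hμ
        have h1 : ¬ (y = x + uvec μ) := fun h' =>
          uvec_add_uvec_ne_zero μ μ₀ (by have := h'.symm.trans h₀'; linear_combination this)
        have h2 : ¬ (y = x - uvec μ) := fun h' => hμ (uvec_injective (sub_right_injective (h'.symm.trans h₀')))
        rw [if_neg h1, if_neg h2, add_zero]
      · intro hμ; exact absurd (Finset.mem_univ μ₀) hμ
  · rw [if_neg h]
    refine Finset.sum_eq_zero fun μ _ => ?_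
    have h1 : ¬ (y = x + uvec μ) := fun h' => h (mem_nbrs.2 ⟨μ, Or.inl h'⟩)
    have h2 : ¬ (y = x - uvec μ) := fun h' => h (mem_nbrs.2 ⟨μ, Or.inr h'⟩)
    rw [if_neg h1, if_neg h2, add_zero]

/-- the number of in-block offsets with a prescribed `μ`-coordinate is `L^d`. [folklore] -/
theorem card_offsets_fixed (μ : Fin (d + 1)) (c : Fin L) :
    (Finset.univ.filter fun j : Fin (d + 1) → Fin L => j μ = c).card = L ^ d := by
  classical
  have h := Fintype.card_filter_piFinset_const_eq_of_mem (Finset.univ : Finset (Fin L)) μ (Finset.mem_univ c)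
  rw [Fintype.piFinset_univ, Finset.card_univ, Fintype.card_fin, Fintype.card_fin, Nat.add_sub_cancel] at h
  exact h

end Labels

/-! ### §2 The nearest-neighbour sum of a block-constant function: the face count -/

section Faces

variable {L : ℕ} [NeZero L] {R' : Finset (Fin (d + 1) → ℤ)} (hR'L : IsBlockUnion L R')

omit [NeZero L] in
/-- the directional coarse sums `A⁺_μ(X) = Σ_Y[Y = X + e_μ](V_X − V_Y)²`, `A⁻_μ(X) = Σ_Y[Y = X − e_μ](V_X − V_Y)²` are non-negative.
[folklore] -/
theorem dirSum_nonneg (V : ↥(R'.image (blk L)) → ℝ) (X : ↥(R'.image (blk L))) (p : Fin (d + 1) → ℤ) :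
    0 ≤ ∑ Y : ↥(R'.image (blk L)), (if Y.1 = p then (V X - V Y) ^ 2 else (0 : ℝ)) :=
  Finset.sum_nonneg fun _ _ => by split_ifs <;> positivity

include hR'L in
/-- **ONE CHART POINT, DIRECTION `+e_μ`**: the fine neighbour `LX + j + e_μ` contributes to the nearest-neighbour sum of `V ∘ blk` at
most `[j_μ + 1 = L]·A⁺_μ(X)`. [folklore] -/
theorem dirPlus_le (V : ↥(R'.image (blk L)) → ℝ) (X : ↥(R'.image (blk L))) (j : Fin (d + 1) → Fin L) (μ : Fin (d + 1)) :
    ∑ y' : ↥R', (if y'.1 = (rchart NeZero.one_le hR'L X j).1 + uvec μ then (V X - V (rblk L R' y')) ^ 2 else (0 : ℝ)) ≤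
      if (j μ : ℕ) + 1 = L then ∑ Y : ↥(R'.image (blk L)), (if Y.1 = X.1 + uvec μ then (V X - V Y) ^ 2 else (0 : ℝ))
      else 0 := by
  classical
  have hL : 1 ≤ L := NeZero.one_le
  have hpt : (rchart NeZero.one_le hR'L X j).1 = finePt L X.1 j := rfl
  by_cases h : (j μ : ℕ) + 1 = L
  · rw [if_pos h]
    by_cases hp : finePt L X.1 j + uvec μ ∈ R'
    · -- exactly one fine point there; its block is `X + e_μ`
      have hblk : (rblk L R' ⟨_, hp⟩).1 = X.1 + uvec μ := blk_finePt_add_uvec_of_eq hL X.1 μ j h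
      have h1 : ∀ y' : ↥R', (y'.1 = (rchart NeZero.one_le hR'L X j).1 + uvec μ) ↔ (y' = ⟨_, hp⟩) := fun y' => by
        rw [hpt, Subtype.ext_iff]
      simp_rw [h1]
      rw [Finset.sum_ite_eq']
      simp only [Finset.mem_univ, if_true]
      exact Finset.single_le_sum (f := fun Y : ↥(R'.image (blk L)) => if Y.1 = X.1 + uvec μ then (V X - V Y) ^ 2 else (0 : ℝ))
        (fun Y _ => by split_ifs <;> positivity) (Finset.mem_univ (rblk L R' ⟨_, hp⟩)) |>.trans' (by rw [if_pos hblk])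
    · have h1 : ∀ y' : ↥R', ¬ (y'.1 = (rchart NeZero.one_le hR'L X j).1 + uvec μ) := fun y' h' =>
        hp (by rw [hpt] at h'; rw [← h']; exact y'.2)
      simp only [h1, if_false, Finset.sum_const_zero]
      exact dirSum_nonneg V X _
  · rw [if_neg h]
    have hlt : (j μ : ℕ) + 1 < L := lt_of_le_of_ne (by have := (j μ).isLt; omega) h
    refine (Finset.sum_eq_zero fun y' _ => ?_).le
    split_ifs with hy
    · have hb : rblk L R' y' = X := by
        apply Subtype.ext
        show blk L y'.1 = X.1
        rw [hy, hpt, blk_finePt_add_uvec_of_lt hL X.1 μ j hlt]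
      rw [hb, sub_self, zero_pow two_ne_zero]
    · rfl

include hR'L in
/-- **ONE CHART POINT, DIRECTION `−e_μ`**: the fine neighbour `LX + j − e_μ` contributes at most `[j_μ = 0]·A⁻_μ(X)`. [folklore] -/
theorem dirMinus_le (V : ↥(R'.image (blk L)) → ℝ) (X : ↥(R'.image (blk L))) (j : Fin (d + 1) → Fin L) (μ : Fin (d + 1)) :
    ∑ y' : ↥R', (if y'.1 = (rchart NeZero.one_le hR'L X j).1 - uvec μ then (V X - V (rblk L R' y')) ^ 2 else (0 : ℝ)) ≤
      if (j μ : ℕ) = 0 then ∑ Y : ↥(R'.image (blk L)), (if Y.1 = X.1 - uvec μ then (V X - V Y) ^ 2 else (0 : ℝ))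
      else 0 := by
  classical
  have hL : 1 ≤ L := NeZero.one_le
  have hpt : (rchart NeZero.one_le hR'L X j).1 = finePt L X.1 j := rfl
  by_cases h : (j μ : ℕ) = 0
  · rw [if_pos h]
    by_cases hp : finePt L X.1 j - uvec μ ∈ R'
    · have hblk : (rblk L R' ⟨_, hp⟩).1 = X.1 - uvec μ := blk_finePt_sub_uvec_of_zero hL X.1 μ j h
      have h1 : ∀ y' : ↥R', (y'.1 = (rchart NeZero.one_le hR'L X j).1 - uvec μ) ↔ (y' = ⟨_, hp⟩) := fun y' => by
        rw [hpt, Subtype.ext_iff]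
      simp_rw [h1]
      rw [Finset.sum_ite_eq']
      simp only [Finset.mem_univ, if_true]
      exact Finset.single_le_sum (f := fun Y : ↥(R'.image (blk L)) => if Y.1 = X.1 - uvec μ then (V X - V Y) ^ 2 else (0 : ℝ))
        (fun Y _ => by split_ifs <;> positivity) (Finset.mem_univ (rblk L R' ⟨_, hp⟩)) |>.trans' (by rw [if_pos hblk])
    · have h1 : ∀ y' : ↥R', ¬ (y'.1 = (rchart NeZero.one_le hR'L X j).1 - uvec μ) := fun y' h' =>
        hp (by rw [hpt] at h'; rw [← h']; exact y'.2)
      simp only [h1, if_false, Finset.sum_const_zero]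
      exact dirSum_nonneg V X _
  · rw [if_neg h]
    have hpos : 0 < (j μ : ℕ) := Nat.pos_of_ne_zero h
    refine (Finset.sum_eq_zero fun y' _ => ?_).le
    split_ifs with hy
    · have hb : rblk L R' y' = X := by
        apply Subtype.ext
        show blk L y'.1 = X.1
        rw [hy, hpt, blk_finePt_sub_uvec_of_pos hL X.1 μ j hpos]
      rw [hb, sub_self, zero_pow two_ne_zero]
    · rfl

/-- the directional split of a nearest-neighbour sum on the fine lattice: `Σ_{y′}[y′ ~ x′]·G(y′) =
Σ_μ(Σ_{y′}[y′ = x′ + e_μ]·G(y′) + Σ_{y′}[y′ = x′ − e_μ]·G(y′))`. [folklore] -/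
theorem nbr_sum_eq_sum_dir (x' : ↥R') (G : ↥R' → ℝ) :
    ∑ y' : ↥R', (if y'.1 ∈ nbrs x'.1 then G y' else 0) =
      ∑ μ : Fin (d + 1), (∑ y' : ↥R', (if y'.1 = x'.1 + uvec μ then G y' else 0) +
        ∑ y' : ↥R', (if y'.1 = x'.1 - uvec μ then G y' else 0)) := by
  calc ∑ y' : ↥R', (if y'.1 ∈ nbrs x'.1 then G y' else 0)
      = ∑ y' : ↥R', ∑ μ : Fin (d + 1), ((if y'.1 = x'.1 + uvec μ then G y' else 0) +
          (if y'.1 = x'.1 - uvec μ then G y' else 0)) :=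
        Finset.sum_congr rfl fun y' _ => (sum_dir_ite_eq x'.1 y'.1 (G y')).symm
    _ = ∑ μ : Fin (d + 1), ∑ y' : ↥R', ((if y'.1 = x'.1 + uvec μ then G y' else 0) +
          (if y'.1 = x'.1 - uvec μ then G y' else 0)) := Finset.sum_comm
    _ = _ := Finset.sum_congr rfl fun μ _ => Finset.sum_add_distrib

include hR'L in
/-- **THE FACE COUNT**: for a block-constant function, `Σ_{x′}Σ_{y′~x′}(V(blk x′) − V(blk y′))² ≤ L^d·Σ_xΣ_{y~x}(V_x − V_y)²` — each
coarse bond is crossed by exactly `L^d` fine bonds (an equality; `≤` is what is consumed). [folklore] -/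
theorem fineDirichlet_blockConst_le (V : ↥(R'.image (blk L)) → ℝ) :
    ∑ x' : ↥R', ∑ y' : ↥R', (if y'.1 ∈ nbrs x'.1 then (V (rblk L R' x') - V (rblk L R' y')) ^ 2 else (0 : ℝ)) ≤
      (L : ℝ) ^ d * ∑ x : ↥(R'.image (blk L)), ∑ y : ↥(R'.image (blk L)),
        (if y.1 ∈ nbrs x.1 then (V x - V y) ^ 2 else (0 : ℝ)) := by
  classical
  have hL : 1 ≤ L := NeZero.one_le
  -- reorganise the fine sum by blocks and offsets, and split by directions
  rw [sum_eq_sum_blocks hR'L]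
  simp_rw [rblk_rchart]
  have hpt : ∀ (X : ↥(R'.image (blk L))) (j : Fin (d + 1) → Fin L),
      ∑ y' : ↥R', (if y'.1 ∈ nbrs (rchart NeZero.one_le hR'L X j).1 then (V X - V (rblk L R' y')) ^ 2 else (0 : ℝ)) ≤
        ∑ μ : Fin (d + 1), ((if (j μ : ℕ) + 1 = L then
            ∑ Y : ↥(R'.image (blk L)), (if Y.1 = X.1 + uvec μ then (V X - V Y) ^ 2 else (0 : ℝ)) else 0) +
          (if (j μ : ℕ) = 0 then
            ∑ Y : ↥(R'.image (blk L)), (if Y.1 = X.1 - uvec μ then (V X - V Y) ^ 2 else (0 : ℝ)) else 0)) := by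
    intro X j
    rw [nbr_sum_eq_sum_dir]
    exact Finset.sum_le_sum fun μ _ => add_le_add (dirPlus_le hR'L V X j μ) (dirMinus_le hR'L V X j μ)
  refine (Finset.sum_le_sum fun X _ => Finset.sum_le_sum fun j _ => hpt X j).trans (le_of_eq ?_)
  -- count the offsets: `#{j : j_μ = L−1} = #{j : j_μ = 0} = L^d`
  have hlast : ∀ μ : Fin (d + 1), ∀ A : ℝ,
      ∑ j : Fin (d + 1) → Fin L, (if (j μ : ℕ) + 1 = L then A else 0) = (L : ℝ) ^ d * A := by
    intro μ A
    have e : ∀ j : Fin (d + 1) → Fin L, ((j μ : ℕ) + 1 = L) ↔ (j μ = ⟨L - 1, by omega⟩) := fun j => by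
      rw [Fin.ext_iff]; constructor <;> intro h' <;> simp only at h' ⊢ <;> omega
    simp_rw [e]
    rw [← Finset.sum_filter, Finset.sum_const, card_offsets_fixed, nsmul_eq_mul]
    push_cast
    ring
  have hzero : ∀ μ : Fin (d + 1), ∀ A : ℝ,
      ∑ j : Fin (d + 1) → Fin L, (if (j μ : ℕ) = 0 then A else 0) = (L : ℝ) ^ d * A := by
    intro μ A
    have e : ∀ j : Fin (d + 1) → Fin L, ((j μ : ℕ) = 0) ↔ (j μ = ⟨0, by omega⟩) := fun j => by
      rw [Fin.ext_iff]
    simp_rw [e]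
    rw [← Finset.sum_filter, Finset.sum_const, card_offsets_fixed, nsmul_eq_mul]
    push_cast
    ring
  -- per block: `Σ_j Σ_μ (…) = L^d·Σ_Y [Y ~ X](V_X − V_Y)²`
  rw [Finset.mul_sum]
  refine Finset.sum_congr rfl fun X _ => ?_
  calc ∑ j : Fin (d + 1) → Fin L, ∑ μ : Fin (d + 1), ((if (j μ : ℕ) + 1 = L then
            ∑ Y : ↥(R'.image (blk L)), (if Y.1 = X.1 + uvec μ then (V X - V Y) ^ 2 else (0 : ℝ)) else 0) +
          (if (j μ : ℕ) = 0 then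
            ∑ Y : ↥(R'.image (blk L)), (if Y.1 = X.1 - uvec μ then (V X - V Y) ^ 2 else (0 : ℝ)) else 0))
      = ∑ μ : Fin (d + 1), ∑ j : Fin (d + 1) → Fin L, ((if (j μ : ℕ) + 1 = L then
            ∑ Y : ↥(R'.image (blk L)), (if Y.1 = X.1 + uvec μ then (V X - V Y) ^ 2 else (0 : ℝ)) else 0) +
          (if (j μ : ℕ) = 0 then
            ∑ Y : ↥(R'.image (blk L)), (if Y.1 = X.1 - uvec μ then (V X - V Y) ^ 2 else (0 : ℝ)) else 0)) :=
        Finset.sum_comm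
    _ = ∑ μ : Fin (d + 1), ((L : ℝ) ^ d * ∑ Y : ↥(R'.image (blk L)), (if Y.1 = X.1 + uvec μ then (V X - V Y) ^ 2 else (0 : ℝ)) +
          (L : ℝ) ^ d * ∑ Y : ↥(R'.image (blk L)), (if Y.1 = X.1 - uvec μ then (V X - V Y) ^ 2 else (0 : ℝ))) := by
        refine Finset.sum_congr rfl fun μ _ => ?_
        rw [Finset.sum_add_distrib, hlast, hzero]
    _ = (L : ℝ) ^ d * ∑ μ : Fin (d + 1), ∑ Y : ↥(R'.image (blk L)),
          ((if Y.1 = X.1 + uvec μ then (V X - V Y) ^ 2 else (0 : ℝ)) + (if Y.1 = X.1 - uvec μ then (V X - V Y) ^ 2 else 0)) := by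
        rw [Finset.mul_sum]
        refine Finset.sum_congr rfl fun μ _ => ?_
        rw [Finset.sum_add_distrib, mul_add]
    _ = (L : ℝ) ^ d * ∑ Y : ↥(R'.image (blk L)), (if Y.1 ∈ nbrs X.1 then (V X - V Y) ^ 2 else (0 : ℝ)) := by
        congr 1
        rw [Finset.sum_comm]
        exact Finset.sum_congr rfl fun Y _ => sum_dir_ite_eq X.1 Y.1 _

end Faces

/-! ### §3 The sharp upper comparison: `P_B^{Schur} ⪯ L·P_A` -/

section Upper

variable {n L : ℕ} [NeZero L] {R' : Finset (Fin (d + 1) → ℤ)}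

/-- **TWO-RUN COMPARISON AT `A = 0`, SHARP UPPER HALF**: `⟨V, P_B^{Schur}V⟩ ≤ L·⟨V, P_A V⟩` for every `V` on run A's lattice
(`a > 0`, `n ≥ 1`, `R′` a union of `nL`-blocks) — Löwner `P_B^{Schur} ⪯ L·P_A`, replacing `NE7K1LinTwoRunUpper.schurB_form_le`'s `L²`.
[folklore] -/
theorem schurB_form_le_sharp (hn : 1 ≤ n) (hR' : IsBlockUnion (n * L) R') {a : ℝ} (ha : 0 < a)
    (V : ↥(R'.image (blk L)) → ℝ) :
    V ⬝ᵥ (twoCutoffLine (isBlockUnion_fine hR') n a 1).mulVec V ≤ (L : ℝ) * (V ⬝ᵥ (runA n L a R').mulVec V) := by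
  classical
  have hL : 1 ≤ L := NeZero.one_le
  have hR'L : IsBlockUnion L R' := isBlockUnion_fine hR'
  have hRc : IsBlockUnion n (R'.image (blk L)) := isBlockUnion_coarse hL hR'
  have hnL : 1 ≤ n * L := Nat.one_le_iff_ne_zero.2 (Nat.mul_ne_zero (Nat.one_le_iff_ne_zero.1 hn) (NeZero.ne L))
  have hLpos : (0 : ℝ) < L := by exact_mod_cast hL
  have hLpow : (0 : ℝ) < (L : ℝ) ^ (d + 1) := pow_pos hLpos _
  have hL1 : (1 : ℝ) ≤ (L : ℝ) := by exact_mod_cast hL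
  refine (schurB_form_le_trial hn hR' ha V).trans ?_
  rw [runB, dot_congr_mulVec, coordT_inl hR'L V, fineOpR_form hnL hR' a 0, runA, fineOpR_form hn hRc a 0, zero_mul, add_zero,
    zero_mul, add_zero, mul_add]
  have havg := avgPart_eq hn a (fun x' => V (rblk L R' x')) V (fun b => by
    have := blockSum_coordT hR'L (Sum.elim V 0) b
    rw [coordT_inl hR'L V] at this
    exact this)
  have hdir := fineDirichlet_blockConst_le hR'L V
  have hcoarse_nn : 0 ≤ ∑ x : ↥(R'.image (blk L)), ∑ y : ↥(R'.image (blk L)),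
      (if y.1 ∈ nbrs x.1 then (V x - V y) ^ 2 else (0 : ℝ)) :=
    Finset.sum_nonneg fun _ _ => Finset.sum_nonneg fun _ _ => by split_ifs <;> positivity
  have havg_nn : 0 ≤ a * ((n : ℝ) ^ (d + 1))⁻¹ * ∑ B₀ : ↥((R'.image (blk L)).image (blk n)),
      (∑ b ∈ Finset.univ.filter (fun b => rblk n (R'.image (blk L)) b = B₀), V b) ^ 2 := by
    have : 0 ≤ ∑ B₀ : ↥((R'.image (blk L)).image (blk n)),
        (∑ b ∈ Finset.univ.filter (fun b => rblk n (R'.image (blk L)) b = B₀), V b) ^ 2 :=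
      Finset.sum_nonneg fun _ _ => sq_nonneg _
    positivity
  rw [havg, mul_add]
  have hdir' : ((L : ℝ) ^ (d + 1))⁻¹ * (((n * L : ℕ) : ℝ) ^ 2 / 2 *
      ∑ x' : ↥R', ∑ y' : ↥R', (if y'.1 ∈ nbrs x'.1 then (V (rblk L R' x') - V (rblk L R' y')) ^ 2 else 0)) ≤
      (L : ℝ) * ((n : ℝ) ^ 2 / 2 * ∑ x : ↥(R'.image (blk L)), ∑ y : ↥(R'.image (blk L)),
        (if y.1 ∈ nbrs x.1 then (V x - V y) ^ 2 else 0)) := by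
    have h1 := mul_le_mul_of_nonneg_left hdir (show (0 : ℝ) ≤ ((L : ℝ) ^ (d + 1))⁻¹ * (((n * L : ℕ) : ℝ) ^ 2 / 2) by
      positivity)
    have e : ((L : ℝ) ^ (d + 1))⁻¹ * (((n * L : ℕ) : ℝ) ^ 2 / 2) * ((L : ℝ) ^ d *
        ∑ x : ↥(R'.image (blk L)), ∑ y : ↥(R'.image (blk L)), (if y.1 ∈ nbrs x.1 then (V x - V y) ^ 2 else 0)) =
        (L : ℝ) * ((n : ℝ) ^ 2 / 2 * ∑ x : ↥(R'.image (blk L)), ∑ y : ↥(R'.image (blk L)),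
          (if y.1 ∈ nbrs x.1 then (V x - V y) ^ 2 else 0)) := by
      have hLd : (L : ℝ) ^ (d + 1) = (L : ℝ) ^ d * L := pow_succ _ _
      rw [hLd]
      push_cast
      field_simp
    rw [← e]
    linarith [h1]
  have hA := le_mul_of_one_le_left havg_nn hL1
  linarith [hdir', hA]

end Upper

end Summit.QuantumFields.BalabanUV.T4Continuum.NE7K1LinTwoRunFaces
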